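import Mathlib

/-!
# The germ funnel at a swirling cone: elementary constants and the skew energy identity (K26)

Solo seat `solo-NavierStokesRegularity-informed`, session 13; companion of
`paper/axisymmetric-rigidity.md` §5c (Lemma 8.14, Proposition 8.15). Lemma 8.14 encloses the analytic germ of
the reduced cone system at a swirling cone `(z₁, σ)` in a funnel `|Y - T_d| ≤ E |ψ|^{d+1}` around its exact Taylor
polynomial; the closing inequalities are checked in exact rational arithmetic by `work/cone/trap/certT_point.py`,
using exactly two transcendental inequalities, certified here:

* `germFunnel_tan_le`: `tan x ≤ x + x³/2` on `[0, 1/2]` (used to bound `cot (z₁ - ψ₀)` from above by a rational);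
  [the second one, `exp x ≤ 1 + x + x²` on `[0, 1]` for the Grönwall factor `e^{κ₁ ψ₀}`, is already in the tree as
  `Literature.Barriers.ValiantsHypothesis.exp_le_quadratic` and is not restated];

and the structural fact that makes the funnel close without losing an order at the singular point:

* `germFunnel_skew_energy`: the singular coupling `(2 T_s / v) · J` of the `(u, s)`-errors is skew, so it drops out of
  `d/dψ (e_u² + e_s²)` whatever its (unbounded) size;
* `germFunnel_moment`: `∫₀ᵗ x^a dx = t^{a+1}/(a+1)`, the order gained by each integration from the cone.
No new definitions; axioms: standard.
-/

namespace Summit.NavierStokesRegularity.NavierStokesRegularity.Theorems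

/-- `tan x ≤ x + x³/2` for `0 ≤ x ≤ 1/2` (from Mathlib's `Real.sin_bound`, `Real.cos_bound`). -/
theorem germFunnel_tan_le {x : ℝ} (h0 : 0 ≤ x) (h1 : x ≤ 1 / 2) : Real.tan x ≤ x + x ^ 3 / 2 := by
  have hx1 : |x| ≤ 1 := by rw [abs_of_nonneg h0]; linarith
  have hs := Real.sin_bound hx1
  have hc := Real.cos_bound hx1
  rw [abs_of_nonneg h0] at hs hc
  have hs' : Real.sin x ≤ x - x ^ 3 / 6 + x ^ 5 / 100 := by
    have := (abs_le.mp hs).2; linarith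
  have hc' : 1 - x ^ 2 / 2 - x ^ 4 * (5 / 96) ≤ Real.cos x := by
    have := (abs_le.mp hc).1; linarith
  have hx2 : x ^ 2 ≤ 1 / 4 := by nlinarith
  have hx4 : x ^ 4 ≤ 1 / 16 := by nlinarith
  have hcpos : 0 < Real.cos x := by linarith
  rw [Real.tan_eq_sin_div_cos, div_le_iff₀ hcpos]
  have hfac : 0 ≤ x + x ^ 3 / 2 := by positivity
  have hprod : (x + x ^ 3 / 2) * (1 - x ^ 2 / 2 - x ^ 4 * (5 / 96)) ≤ (x + x ^ 3 / 2) * Real.cos x :=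
    mul_le_mul_of_nonneg_left hc' hfac
  have hpoly : x - x ^ 3 / 6 + x ^ 5 / 100 ≤ (x + x ^ 3 / 2) * (1 - x ^ 2 / 2 - x ^ 4 * (5 / 96)) := by
    have h3 : 0 ≤ x ^ 3 := by positivity
    have hb : 0 ≤ 1 / 6 - (1 / 100 + 29 / 96) * x ^ 2 - 5 / 192 * x ^ 4 := by nlinarith
    nlinarith [mul_nonneg h3 hb]
  linarith

/-- The skew energy identity: if `e_u' = k e_s + o_u` and `e_s' = -k e_u + o_s` then
`(e_u² + e_s²)' = 2 (e_u o_u + e_s o_s)` — the coupling `k` (here `2 T_s / v`, unbounded at the cone) drops out. -/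
theorem germFunnel_skew_energy (eu es k ou os : ℝ) :
    2 * eu * (k * es + ou) + 2 * es * (-k * eu + os) = 2 * (eu * ou + es * os) := by
  ring

/-- The order gained by one integration from the cone: `∫₀ᵗ x^a dx = t^{a+1} / (a+1)`. -/
theorem germFunnel_moment (a : ℕ) (t : ℝ) :
    ∫ x in (0 : ℝ)..t, x ^ a = t ^ (a + 1) / (a + 1) := by
  simp [integral_pow]

end Summit.NavierStokesRegularity.NavierStokesRegularity.Theorems
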